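import Literature.MathematicalPhysics.QuantumFieldTheory.LatticeGaugeShenZhuZhuProofs
import HarnessLib

/-!
# `isSpecification_ymSpecification` is mis-stated: an unconditional counterexample, and the
corrected (Hausdorff) named fact with its discharge

Sibling file of `Literature/MathematicalPhysics/QuantumLattice/LatticeGaugeDLR.lean` (trunk
QLatticeAQFT, item A9) concerning the named fact
`Literature.MathematicalPhysics.QuantumLattice.isSpecification_ymSpecification` ("the lattice
Yang–Mills kernels `ymSpecification ρ β` form a specification", cited to Georgii 2011, Def. 2.9
with Prop. 2.5). Nothing in `LatticeGaugeDLR.lean` is changed.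

## The fact is false as stated

As elaborated, `isSpecification_ymSpecification` quantifies over every compact second-countable
topological group `G` with `[BorelSpace G]` but **without** the Hausdorff hypothesis
`[T2Space G]` carried by its sibling facts `infiniteVolumeLimitPoints_nonempty` and
`mem_ymGibbsMeasures_of_mem_infiniteVolumeLimitPoints`. For a non-`T₀` group the Borel σ-algebra
does not separate topologically indistinguishable points, the product σ-algebra on
`G^{edges(ℤ^d)}` is trivial along the inseparable fibres, and the almost-everywhere properness
axiom `IsSpecification.proper` fails for every probability kernel, whereas `ymSpecification ρ β Λ η`
is a genuine probability measure. The tree already records this in hypothetical form: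
`Literature.MathematicalPhysics.QuantumFieldTheory.not_isSpecification_ymSpecification_of_indiscrete`
(file `QuantumFieldTheory/LatticeGaugeShenZhuZhuProofs.lean`) refutes `IsSpecification` for any
nontrivial `G` *assumed* to carry the indiscrete topology together with all the instances the
fact demands. This file supplies such a `G` — `IndiscreteZ2`, the two-element group with the
indiscrete topology, its trivial Borel σ-algebra, and the `IsTopologicalGroup`, `CompactSpace`,
`SecondCountableTopology`, `BorelSpace` instances — and so proves the **unconditional** negation
`not_isSpecification_ymSpecification_indiscrete : ¬ isSpecification_ymSpecification (d := 1) 1`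
of the registered fact at `d = 1`, `G = IndiscreteZ2`, `ρ = 1` (the trivial, continuous,
representation). Consequently no closed `isSpecification_ymSpecification_holds` can exist.
Since the verdict clean-up of 2026-08-15 the registered fact is kept verbatim in `LatticeGaugeDLR.lean`
under `@[deprecated]` (it cannot be deleted while this refutation names it), which is why
`linter.deprecated` is switched off for `not_isSpecification_ymSpecification_indiscrete` alone.

## Corrected statement

`isSpecification_ymSpecification_t2` is the same statement with `[T2Space G]` added — `G` is
then a compact metrisable group, which covers every closed subgroup of `U(N)` (the setting of
Seiler LNP 159 Ch. 2 and Chatterjee arXiv:1803.01950 §2) and matches Georgii's standing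
assumption of a standard Borel spin space (Georgii 2011, §2.1) — written as a *closed*
proposition (the data `d, N, G, ρ` are quantified inside). It is discharged by
`isSpecification_ymSpecification_t2_holds` from the tree's Hausdorff theorem
`Literature.MathematicalPhysics.QuantumFieldTheory.isSpecification_ymSpecification_of_t2Space`
(proved there from the generic Gibbsian-specification theorem
`Literature.Probability.LatticeModels.isSpecification_tilted_map_glueWith_pi`: probability,
`𝓕_{Λᶜ}`-measurability, properness and consistency of the tilted product-Haar kernels;
Georgii 2011, Def. 2.9 with Prop. 2.5; Friedli–Velenik 2017, Lemma 6.15 with §6.10.1 (6.110)).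
No result is re-proved here.

## References

* H.-O. Georgii, *Gibbs Measures and Phase Transitions*, 2nd ed. (de Gruyter 2011), Def. 1.23,
  Def. 2.9 with Prop. 2.5 (Gibbsian specifications are specifications; standing assumption:
  standard Borel spin space, §2.1).
* S. Friedli, Y. Velenik, *Statistical Mechanics of Lattice Systems* (CUP 2017), Def. 6.11,
  Lemma 6.15 (pp. 280–281 of the held copy), §6.10.1 eq. (6.110) (p. 333).
* E. Seiler, LNP 159 (Springer 1982), Ch. 2; S. Chatterjee, arXiv:1803.01950, §2 (the gauge
  group is a closed subgroup of `U(N)`).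
-/

noncomputable section

open MeasureTheory
open Literature.Probability.LatticeModels

namespace Literature.MathematicalPhysics.QuantumLattice

/-! ### A concrete compact, second countable, non-Hausdorff group -/

/-- The two-element group with the **indiscrete** topology: a compact, second countable,
non-Hausdorff topological group whose Borel σ-algebra is trivial (witness type for
`not_isSpecification_ymSpecification_indiscrete`). [folklore] -/
def IndiscreteZ2 : Type := Multiplicative (ZMod 2)

namespace IndiscreteZ2

/-- The group structure of `ℤ/2` (written multiplicatively). [folklore] -/
instance : Group IndiscreteZ2 := inferInstanceAs (Group (Multiplicative (ZMod 2)))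

/-- `ℤ/2` has two elements. [folklore] -/
instance : Nontrivial IndiscreteZ2 := inferInstanceAs (Nontrivial (Multiplicative (ZMod 2)))

/-- `ℤ/2` is finite (whence compact in any topology, `Finite.compactSpace`). [folklore] -/
instance : Finite IndiscreteZ2 := inferInstanceAs (Finite (Multiplicative (ZMod 2)))

/-- The indiscrete topology: only `∅` and everything are open. [folklore] -/
instance : TopologicalSpace IndiscreteZ2 := ⊤

/-- Every map into an indiscrete space is continuous, so this is a topological group. [folklore] -/
instance : IsTopologicalGroup IndiscreteZ2 where
  continuous_mul := continuous_top
  continuous_inv := continuous_top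

/-- The indiscrete topology is generated by the empty (countable) family of sets. [folklore] -/
instance : SecondCountableTopology IndiscreteZ2 :=
  ⟨⟨∅, Set.countable_empty,
    le_antisymm (TopologicalSpace.le_generateFrom_iff_subset_isOpen.2 (Set.empty_subset _)) le_top⟩⟩

/-- The trivial σ-algebra, which is the Borel σ-algebra of the indiscrete topology. [folklore] -/
instance : MeasurableSpace IndiscreteZ2 := ⊥

/-- The Borel σ-algebra of the indiscrete topology is the trivial one. [folklore] -/
instance : BorelSpace IndiscreteZ2 := by
  refine ⟨le_antisymm bot_le (MeasurableSpace.generateFrom_le fun s hs => ?_)⟩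
  rcases (TopologicalSpace.isOpen_top_iff s).1 hs with rfl | rfl
  · exact @MeasurableSet.empty _ ⊥
  · exact @MeasurableSet.univ _ ⊥

/-- The open sets of `IndiscreteZ2` are `∅` and everything. [folklore] -/
theorem eq_empty_or_eq_univ_of_isOpen (s : Set IndiscreteZ2) (hs : IsOpen s) :
    s = ∅ ∨ s = Set.univ :=
  (TopologicalSpace.isOpen_top_iff s).1 hs

end IndiscreteZ2

/-! ### The registered fact fails -/

-- names the `@[deprecated]` record `isSpecification_ymSpecification` of `LatticeGaugeDLR.lean` on purpose: this IS
-- its refutation (verdict clean-up 2026-08-15); REMOVE-WHEN the record is deleted from `LatticeGaugeDLR.lean`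
set_option linter.deprecated false in
/-- **`isSpecification_ymSpecification` is false as stated** (it lacks `[T2Space G]`): at
`d = 1`, for the indiscrete two-element group `IndiscreteZ2` (which carries every instance the
fact asks for) and the trivial representation `ρ = 1` (continuous), the lattice Yang–Mills
kernels are not a specification — properness fails because every event of the product
σ-algebra is `∅` or everything
(`Literature.MathematicalPhysics.QuantumFieldTheory.not_isSpecification_ymSpecification_of_indiscrete`).
See `isSpecification_ymSpecification_t2` for the corrected statement. [folklore] -/
theorem not_isSpecification_ymSpecification_indiscrete (N : ℕ) :
    ¬ isSpecification_ymSpecification (d := 1) (G := IndiscreteZ2)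
      (1 : IndiscreteZ2 →* Matrix (Fin N) (Fin N) ℂ) := by
  intro h
  have hρ : Continuous (⇑(1 : IndiscreteZ2 →* Matrix (Fin N) (Fin N) ℂ)) := continuous_const
  exact QuantumFieldTheory.not_isSpecification_ymSpecification_of_indiscrete (d := 1)
    (1 : IndiscreteZ2 →* Matrix (Fin N) (Fin N) ℂ) IndiscreteZ2.eq_empty_or_eq_univ_of_isOpen 0
    (h hρ 0)

/-! ### The corrected named fact and its discharge -/

section Corrected

universe u

/-- **Corrected form of `isSpecification_ymSpecification`** (same source and locator:
Georgii 2011, Def. 2.9 with Prop. 2.5). The registered fact omits the Hausdorff hypothesis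
`[T2Space G]` of its sibling facts and is false in that generality
(`not_isSpecification_ymSpecification_indiscrete`). With `[T2Space G]` — `G` compact
metrisable, as every closed subgroup of `U(N)` is (Seiler LNP 159 Ch. 2; Chatterjee
arXiv:1803.01950 §2), and as Georgii's standard Borel spin spaces are (Georgii 2011, §2.1) —
the statement reads: for a continuous matrix representation `ρ` of a compact Hausdorff
second-countable group `G`, every dimension `d` and every real `β` (no sign condition), the
lattice Yang–Mills kernels `ymSpecification ρ β` (product Haar measure on the links of `Λ`,
glued with the boundary condition, tilted by `exp(-β S_Λ)`) form a specification in Georgii's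
sense: probability, `𝓕_{Λᶜ}`-measurability, properness, consistency. The data are quantified
inside, so this is a closed proposition; it is discharged by
`isSpecification_ymSpecification_t2_holds`. [cite: Georgii2011, Def. 2.9 with Prop. 2.5] -/
def isSpecification_ymSpecification_t2 : Prop :=
  ∀ {d N : ℕ} {G : Type u} [Group G] [TopologicalSpace G] [IsTopologicalGroup G] [CompactSpace G]
    [MeasurableSpace G] [BorelSpace G] [T2Space G] [SecondCountableTopology G]
    (ρ : G →* Matrix (Fin N) (Fin N) ℂ), Continuous ρ → ∀ β : ℝ,
      IsSpecification (ymSpecification (d := d) ρ β)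

/-- Discharge of `isSpecification_ymSpecification_t2`, from the tree's Hausdorff theorem
`Literature.MathematicalPhysics.QuantumFieldTheory.isSpecification_ymSpecification_of_t2Space`
(an instance of the generic Gibbsian-specification theorem
`Literature.Probability.LatticeModels.isSpecification_tilted_map_glueWith_pi`; Georgii 2011,
Def. 2.9 with Prop. 2.5; Friedli–Velenik 2017, Lemma 6.15 with (6.110)). [cite: Georgii2011, Def. 2.9 with Prop. 2.5] -/
theorem isSpecification_ymSpecification_t2_holds : isSpecification_ymSpecification_t2 :=
  fun ρ hρ β => QuantumFieldTheory.isSpecification_ymSpecification_of_t2Space ρ hρ β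

end Corrected

end Literature.MathematicalPhysics.QuantumLattice
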